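import Mathlib
import HarnessLib
import Summits.HubbardSuperconductivity.HubbardSuperconductivity.Theorems.KLProgrammeThermalGreenMatsubaraWordAllU
import Summits.HubbardSuperconductivity.HubbardSuperconductivity.Theorems.KLProgrammeKLRegimeVolumeLimitSixPointDefs

/-!
# Child `KLRegimeVolumeLimitV12` (stmt-HubbardSuperconductivity-19858), stub `stub_vl_bound`: the supplier-shaped input (P) of
# `stub_vl_bound_of_pointwise_twoPoint` — the all-`U` Matsubara limit of the word six-point numerator, pointwise in the time with
# an `M`-eventual sup bound (seat hubbard-kl-k3c4-p2, g3; technique «Matsubara all-U route (R-a), t2 machine»)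

`…VolumeLimitBoundGlueDominated.stub_vl_bound_of_pointwise_twoPoint` (k3c5-p3) closes the registered `stub_vl_bound` from two inputs at
every `β > 0`, `U`, `μ`, `L ≥ 3`: (P) for every torus site `z`, a pointwise-in-`u ∈ [0,β)` limit of the word six-point numerator
`∫dμ_{C_M} e^{−V}·sixPointWord L M β 0 1 z u` together with an `M`-eventual sup bound on `[0,β]` uniform in `z`; and (H2pt) the per-label
two-point limits (k3c5-p2 / k3c5-p1).  This file DISCHARGES (P), for EVERY real `U` and every `L ≥ 1`: k3c5-p1's `sixPointWord L M β σ τ z u`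
(`…VolumeLimitSixPointDefs`) is the general external pair-word of `…ThermalGreenMatsubaraWordMoments/AllU` with `k = 2` point slots `(z, 0)`,
times `(u, 0)`, `m = 3` pairs and the (injective, `σ ≠ τ`) leg enumerations `Pe = ((0,σ),(0,τ),(1,τ))`, `Qe = ((1,σ),(0,τ),(1,τ))`; the word is
even, so `e^{−V}` may stand on either side.  Then `tendsto_gaussExpect_word_mul_grassmannExp_allU` is the pointwise limit and
`exists_uniform_bound_gaussExpect_word_allU` (constants free of the external times; finitely many `z`) the sup bound:

* `sixPointWord_eq_wordProd`, `sixPointWord_mem_evenOdd_zero`, `grassmannExp_mul_sixPointWord_comm`;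
* **`sixPointWord_pointwise_bound_allU`** — hypothesis (P) verbatim (any `σ ≠ τ`, in particular `(0, 1)`).

Everything is proved; no definition; no smallness in `U`.
-/

namespace Summit.HubbardSuperconductivity.HubbardSuperconductivity.Theorems.MatsubaraAllU

set_option linter.dupNamespace false -- summit = problem name (single-conjunct summit), D-0017

open MeasureTheory Finset Filter Topology Literature.MathematicalPhysics.QuantumLattice
  Literature.Probability.LatticeModels
open Literature.MathematicalPhysics.QuantumLattice.GrassmannAlgebra
open Summit.HubbardSuperconductivity.HubbardSuperconductivity.Theorems.TwoPointAssembly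
open scoped Nat ComplexOrder

noncomputable section

variable {L : ℕ} [NeZero L]

/-- The barred legs of the six-point word as an external enumeration on two point slots (`0 ↦ (z,s)`, `1 ↦ (0,0)`):
pair `0 ↦ (0,σ)`, `1 ↦ (0,τ)`, `2 ↦ (1,τ)`; injective for `σ ≠ τ`. -/
theorem sixPointPe_injective {σ τ : Fin 2} (hστ : σ ≠ τ) :
    Function.Injective (![((0 : Fin 2), σ), ((0 : Fin 2), τ), ((1 : Fin 2), τ)] : Fin 3 → Fin 2 × Fin 2) := by
  intro i j h
  fin_cases i <;> fin_cases j <;> simp_all [Prod.ext_iff]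

/-- The unbarred legs of the six-point word as an external enumeration: pair `0 ↦ (1,σ)`, `1 ↦ (0,τ)`, `2 ↦ (1,τ)`; injective for `σ ≠ τ`. -/
theorem sixPointQe_injective {σ τ : Fin 2} (hστ : σ ≠ τ) :
    Function.Injective (![((1 : Fin 2), σ), ((0 : Fin 2), τ), ((1 : Fin 2), τ)] : Fin 3 → Fin 2 × Fin 2) := by
  intro i j h
  fin_cases i <;> fin_cases j <;> simp_all [Prod.ext_iff]

/-- **The six-point word is the general external pair-word** with point slots `![z, 0]`, times `![s, 0]`, three pairs and the
enumerations `Pe = ((0,σ),(0,τ),(1,τ))`, `Qe = ((1,σ),(0,τ),(1,τ))`. -/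
theorem sixPointWord_eq_wordProd (M : ℕ) (β : ℝ) (σ τ : Fin 2) (z : TorusSite 2 L) (s : ℝ) :
    sixPointWord L M β σ τ z s =
      (List.ofFn fun l : Fin 3 =>
        positionField L M β 0 ((![((0 : Fin 2), σ), ((0 : Fin 2), τ), ((1 : Fin 2), τ)] : Fin 3 → Fin 2 × Fin 2) l).2
            ((![z, 0] : Fin 2 → TorusSite 2 L) ((![((0 : Fin 2), σ), ((0 : Fin 2), τ), ((1 : Fin 2), τ)] : Fin 3 → Fin 2 × Fin 2) l).1)
            ((![s, 0] : Fin 2 → ℝ) ((![((0 : Fin 2), σ), ((0 : Fin 2), τ), ((1 : Fin 2), τ)] : Fin 3 → Fin 2 × Fin 2) l).1) *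
          positionField L M β 1 ((![((1 : Fin 2), σ), ((0 : Fin 2), τ), ((1 : Fin 2), τ)] : Fin 3 → Fin 2 × Fin 2) l).2
            ((![z, 0] : Fin 2 → TorusSite 2 L) ((![((1 : Fin 2), σ), ((0 : Fin 2), τ), ((1 : Fin 2), τ)] : Fin 3 → Fin 2 × Fin 2) l).1)
            ((![s, 0] : Fin 2 → ℝ) ((![((1 : Fin 2), σ), ((0 : Fin 2), τ), ((1 : Fin 2), τ)] : Fin 3 → Fin 2 × Fin 2) l).1)).prod := by
  rw [sixPointWord, List.ofFn_succ, List.ofFn_succ, List.ofFn_succ, List.ofFn_zero, List.prod_cons, List.prod_cons, List.prod_cons,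
    List.prod_nil]
  simp [mul_assoc]

/-- **The six-point word is even** (a product of six fields). -/
theorem sixPointWord_mem_evenOdd_zero (M : ℕ) (β : ℝ) (σ τ : Fin 2) (z : TorusSite 2 L) (s : ℝ) :
    sixPointWord L M β σ τ z s ∈ evenOdd ℂ (0 : ZMod 2) := by
  have hpair : ∀ (c₁ c₂ ς₁ ς₂ : Fin 2) (y₁ y₂ : TorusSite 2 L) (r₁ r₂ : ℝ),
      positionField L M β c₁ ς₁ y₁ r₁ * positionField L M β c₂ ς₂ y₂ r₂ ∈ evenOdd ℂ (0 : ZMod 2) := by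
    intro c₁ c₂ ς₁ ς₂ y₁ y₂ r₁ r₂
    have h := SetLike.mul_mem_graded (positionField_mem_evenOdd_one (L := L) (M := M) β c₁ ς₁ y₁ r₁)
      (positionField_mem_evenOdd_one (L := L) (M := M) β c₂ ς₂ y₂ r₂)
    have h11 : ((1 : ZMod 2) + 1) = 0 := by decide
    rwa [h11] at h
  have hmul : ∀ {a b : HubbardGrassmann L M}, a ∈ evenOdd ℂ (0 : ZMod 2) → b ∈ evenOdd ℂ (0 : ZMod 2) →
      a * b ∈ evenOdd ℂ (0 : ZMod 2) := by
    intro a b ha hb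
    have h := SetLike.mul_mem_graded ha hb
    rwa [add_zero] at h
  unfold sixPointWord
  exact hmul (hmul (hpair 0 1 σ σ z 0 s 0) (hpair 0 1 τ τ z z s s)) (hpair 0 1 τ τ 0 0 0 0)

/-- `e^{−V}` may stand on either side of the six-point word (the word is even, hence central). -/
theorem grassmannExp_mul_sixPointWord_comm (M : ℕ) (β U : ℝ) (σ τ : Fin 2) (z : TorusSite 2 L) (s : ℝ) :
    grassmannExp (-(hubbardInteraction L M β U)) * sixPointWord L M β σ τ z s =
      sixPointWord L M β σ τ z s * grassmannExp (-(hubbardInteraction L M β U)) :=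
  ((commute_of_mem_evenOdd_zero ℂ (sixPointWord_mem_evenOdd_zero M β σ τ z s)
    (grassmannExp (-(hubbardInteraction L M β U)))).eq).symm

/-- **Hypothesis (P) of `stub_vl_bound_of_pointwise_twoPoint`, for EVERY coupling** (`β > 0`, any `U, μ`, `L ≥ 1`, `σ ≠ τ`): there are a
limit `S_∞ : TorusSite 2 L → ℝ → ℂ` and a constant `C` with
(i) `∫dμ_{C_M} e^{−V}·sixPointWord L M β σ τ z u ⟶ S_∞ z u` as `M → ∞` for every site `z` and every `u ∈ [0,β)`, and
(ii) eventually in `M`: `‖∫dμ_{C_M} e^{−V}·sixPointWord L M β σ τ z u‖ ≤ C` for all `z` and all `u ∈ [0,β]`.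
(t2's machine for a general word: `tendsto_gaussExpect_word_mul_grassmannExp_allU`, `exists_uniform_bound_gaussExpect_word_allU`; the limit is the
determinant series of `vertexLimitEntry`'s, not identified with anything here.) -/
theorem sixPointWord_pointwise_bound_allU {β : ℝ} (hβ : 0 < β) (U μ : ℝ) {σ τ : Fin 2} (hστ : σ ≠ τ) :
    ∃ (Sinf : TorusSite 2 L → ℝ → ℂ) (C : ℝ),
      (∀ z : TorusSite 2 L, ∀ u ∈ Set.Ico (0 : ℝ) β, Tendsto (fun M : ℕ =>
        gaussExpect ℂ (hubbardCovariance L M β μ 0) (grassmannExp (-(hubbardInteraction L M β U)) * sixPointWord L M β σ τ z u))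
          atTop (𝓝 (Sinf z u))) ∧
      (∀ᶠ M : ℕ in atTop, ∀ (z : TorusSite 2 L), ∀ u ∈ Set.Icc (0 : ℝ) β,
        ‖gaussExpect ℂ (hubbardCovariance L M β μ 0) (grassmannExp (-(hubbardInteraction L M β U)) * sixPointWord L M β σ τ z u)‖ ≤ C) := by
  classical
  set Pe : Fin 3 → Fin 2 × Fin 2 := ![((0 : Fin 2), σ), ((0 : Fin 2), τ), ((1 : Fin 2), τ)] with hPe
  set Qe : Fin 3 → Fin 2 × Fin 2 := ![((1 : Fin 2), σ), ((0 : Fin 2), τ), ((1 : Fin 2), τ)] with hQe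
  have hPe_inj : Function.Injective Pe := sixPointPe_injective hστ
  have hQe_inj : Function.Injective Qe := sixPointQe_injective hστ
  -- external times `(u, 0)` lie in `[0,β)` resp. `[0,β]`
  have hse : ∀ u ∈ Set.Ico (0 : ℝ) β, ∀ p : Fin 2, (![u, 0] : Fin 2 → ℝ) p ∈ Set.Ico (0 : ℝ) β := by
    intro u hu p
    fin_cases p
    · simpa using hu
    · simpa using hβ
  have hseI : ∀ u ∈ Set.Icc (0 : ℝ) β, ∀ p : Fin 2, (![u, 0] : Fin 2 → ℝ) p ∈ Set.Icc (0 : ℝ) β := by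
    intro u hu p
    fin_cases p
    · simpa using hu
    · simpa using hβ.le
  -- the word identity, with `e^{−V}` moved to the right
  have hword : ∀ (M : ℕ) (z : TorusSite 2 L) (u : ℝ),
      grassmannExp (-(hubbardInteraction L M β U)) * sixPointWord L M β σ τ z u =
        (List.ofFn fun l : Fin 3 => positionField L M β 0 (Pe l).2 ((![z, 0] : Fin 2 → TorusSite 2 L) (Pe l).1)
            ((![u, 0] : Fin 2 → ℝ) (Pe l).1) *
          positionField L M β 1 (Qe l).2 ((![z, 0] : Fin 2 → TorusSite 2 L) (Qe l).1) ((![u, 0] : Fin 2 → ℝ) (Qe l).1)).prod *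
          grassmannExp (-(hubbardInteraction L M β U)) := by
    intro M z u
    rw [grassmannExp_mul_sixPointWord_comm, sixPointWord_eq_wordProd]
  -- (ii) the sup bound: constants per site, then the maximum over the finitely many sites
  choose Cz hCz0 Mz hMz using fun z : TorusSite 2 L =>
    exists_uniform_bound_gaussExpect_word_allU (L := L) hβ μ U (![z, 0] : Fin 2 → TorusSite 2 L) Pe Qe hPe_inj hQe_inj
  obtain ⟨C, hC⟩ := Finite.exists_le Cz
  obtain ⟨M₀, hM₀⟩ := Finite.exists_le Mz
  refine ⟨fun z u => ∑' n : ℕ, ((-1 : ℂ) ^ n * ((n ! : ℂ))⁻¹) * ((U : ℂ) ^ n * ∑ x : Fin n → TorusSite 2 L,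
      ∫ t in Set.Icc (0 : Fin n → ℝ) (fun _ => β),
      (Matrix.of fun i j : Fin (3 + n * 2) =>
        vertexLimitEntry L β μ
          ((Fin.append x ![z, 0] : Fin (n + 2) → TorusSite 2 L)
            (Fin.append (fun l : Fin 3 => ((Fin.natAdd n (Pe l).1 : Fin (n + 2)), (Pe l).2))
              (fun i : Fin (n * 2) => ((Fin.castAdd 2 (finProdFinEquiv.symm i : Fin n × Fin 2).1 : Fin (n + 2)),
                (finProdFinEquiv.symm i : Fin n × Fin 2).2)) i).1)
          ((Fin.append x ![z, 0] : Fin (n + 2) → TorusSite 2 L)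
            (Fin.append (fun l : Fin 3 => ((Fin.natAdd n (Qe l).1 : Fin (n + 2)), (Qe l).2))
              (fun j : Fin (n * 2) => ((Fin.castAdd 2 (finProdFinEquiv.symm j : Fin n × Fin 2).1 : Fin (n + 2)),
                (finProdFinEquiv.symm j : Fin n × Fin 2).2)) j).1)
          (Fin.append (fun l : Fin 3 => ((Fin.natAdd n (Pe l).1 : Fin (n + 2)), (Pe l).2))
            (fun i : Fin (n * 2) => ((Fin.castAdd 2 (finProdFinEquiv.symm i : Fin n × Fin 2).1 : Fin (n + 2)),
              (finProdFinEquiv.symm i : Fin n × Fin 2).2)) i).2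
          (Fin.append (fun l : Fin 3 => ((Fin.natAdd n (Qe l).1 : Fin (n + 2)), (Qe l).2))
            (fun j : Fin (n * 2) => ((Fin.castAdd 2 (finProdFinEquiv.symm j : Fin n × Fin 2).1 : Fin (n + 2)),
              (finProdFinEquiv.symm j : Fin n × Fin 2).2)) j).2
          ((Fin.append t ![u, 0] : Fin (n + 2) → ℝ)
              (Fin.append (fun l : Fin 3 => ((Fin.natAdd n (Qe l).1 : Fin (n + 2)), (Qe l).2))
                (fun j : Fin (n * 2) => ((Fin.castAdd 2 (finProdFinEquiv.symm j : Fin n × Fin 2).1 : Fin (n + 2)),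
                  (finProdFinEquiv.symm j : Fin n × Fin 2).2)) j).1 -
            (Fin.append t ![u, 0] : Fin (n + 2) → ℝ)
              (Fin.append (fun l : Fin 3 => ((Fin.natAdd n (Pe l).1 : Fin (n + 2)), (Pe l).2))
                (fun i : Fin (n * 2) => ((Fin.castAdd 2 (finProdFinEquiv.symm i : Fin n × Fin 2).1 : Fin (n + 2)),
                  (finProdFinEquiv.symm i : Fin n × Fin 2).2)) i).1)).det), C, ?_, ?_⟩
  · -- (i) the pointwise limit on `[0,β)`
    intro z u hu
    simp_rw [hword]
    exact tendsto_gaussExpect_word_mul_grassmannExp_allU hβ μ U _ (hse u hu) Pe Qe hPe_inj hQe_inj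
  · -- (ii) the eventual sup bound on `[0,β]`, uniform in the site
    filter_upwards [eventually_ge_atTop M₀] with M hM z u hu
    rw [hword]
    exact (hMz z M ((hM₀ z).trans hM) _ (hseI u hu)).trans (hC z)

end

end Summit.HubbardSuperconductivity.HubbardSuperconductivity.Theorems.MatsubaraAllU
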